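import Mathlib
import Literature.Analysis.OperatorTheory.CompactEmbeddingFormSpectrum
import HarnessLib

/-!
# Eigenbasis of a diagonal operator with eigenvalues `→ +∞` perturbed by a bounded self-adjoint
# operator

Topic `Literature/Analysis/OperatorTheory`. The abstract spectral statement behind the
completeness of perturbed classical orthonormal systems (spheroidal harmonics from spherical
harmonics, anharmonic from harmonic oscillator eigenfunctions, …): **a self-adjoint operator with
compact resolvent perturbed by a bounded self-adjoint operator still has compact resolvent, hence a
complete orthonormal set of eigenvectors with eigenvalues `→ +∞`** (Reed–Simon IV, Thm. XIII.64
(characterisations of compact resolvent) with Thm. XIII.68-type stability; Kato, *Perturbation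
theory*, V §3.5 / IV Thm. 3.17 (relatively bounded perturbations preserve compactness of the
resolvent)), in the concrete coordinates in which such operators are given in the tree — by their
action on a Hilbert basis.

Setting: `e` a Hilbert basis of a Hilbert space `H` over `𝕜 = ℝ, ℂ` indexed by `ι`; real levels
`d : ι → ℝ`, bounded below by `d₀` and tending to `+∞` along the cofinite filter (the unperturbed
operator `D = diag(d)`, `D e_i = d_i e_i`, self-adjoint with compact resolvent); `B : H →L H`
self-adjoint (the perturbation). The perturbed operator `A = D + B` is handled WITHOUT unbounded
operators, through coefficients: `A f = λ f` means `d_i ⟨e_i, f⟩ + ⟨e_i, B f⟩ = λ ⟨e_i, f⟩` for all `i`.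

* `lpDiag`, `basisDiag e r C hr` — the bounded diagonal operator `e_i ↦ r_i e_i` of a
  bounded scalar sequence (`repr_diag`, `inner_basis_diag`, `diag_basis`, norm bound
  `norm_diag_le`, difference `diag_sub_diag`), self-adjoint for real `r` (`isSelfAdjoint_diag`),
  injective for non-vanishing `r` (`diag_injective`), and **compact when `r_i → 0`**
  (`isCompactOperator_diag`: operator-norm limit of its finite-rank truncations `diag_indicator_eq_sum`);
* `exists_hilbertBasis_diag_add` — **THE THEOREM**: there are a Hilbert basis `(f_j)_{j ∈ s}` of `H`
  and real `λ_j` with `λ_j → +∞` cofinitely, `λ_j ≥ d₀ - ‖B‖`, and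
  `d_i ⟨e_i, f_j⟩ + ⟨e_i, B f_j⟩ = λ_j ⟨e_i, f_j⟩` for all `i, j`.

Proof (Reed–Simon's resolvent argument in coordinates): with `c = 2‖B‖ + 1 - d₀` the diagonal
resolvent `R₀ = diag((d_i + c)⁻¹)` is compact, self-adjoint, injective, `‖R₀‖ ≤ (2‖B‖+1)⁻¹`, so
`‖R₀ B‖ < 1` and `R = (1 + R₀ B)⁻¹ R₀` (Neumann series, `Units.oneSub`) is compact, injective and
symmetric (`⟨R x, y⟩ = ⟨x, R y⟩` from `R x = R₀ (x - B R x)` and the symmetry of `R₀`, `B`);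
`CompactSelfAdjointEigenbasis.exists_hilbertBasis_eigenvectors` gives a Hilbert basis with
`R f_j = κ_j f_j`, `κ_j ≠ 0`, and unwinding `R` gives the coefficient eigen-equation with
`λ_j = κ_j⁻¹ - c`; the variational identity `λ_j - Re⟨f_j, B f_j⟩ = Σ_i d_i |⟨e_i, f_j⟩|² ≥ d₀` gives
`λ_j ≥ d₀ - ‖B‖`, whence `κ_j > 0`, and `κ_j → 0` (eigenvalues of a compact operator along an
orthonormal family, `tendsto_norm_eigenvalue_cofinite`) gives `λ_j → +∞`. Everything is proved; no
named facts, no new notions beyond the diagonal operator.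

## References

* M. Reed, B. Simon, *Methods of Modern Mathematical Physics IV: Analysis of Operators* (1978),
  Thm. XIII.64 (operators with compact resolvent ⟺ complete eigenbasis with `λ_n → ∞`).
  [ReedSimonIV1978]
* M. Reed, B. Simon, *Methods of Modern Mathematical Physics I* (1980), Thm. VI.16
  (Hilbert–Schmidt theorem). [ReedSimonI1980]
-/

noncomputable section

open Filter Topology Set ContinuousLinearMap
open scoped InnerProductSpace ComplexConjugate ENNReal

namespace Literature.Analysis.OperatorTheory

variable {ι : Type*} {𝕜 : Type*} [RCLike 𝕜]
variable {H : Type*} [NormedAddCommGroup H] [InnerProductSpace 𝕜 H]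

/-! ### Multiplication by a bounded sequence on `ℓ²` -/

section LpDiag

/-- A bounded scalar sequence multiplies `lp (fun _ : ι ↦ 𝕜) 2` into itself. [folklore] -/
theorem memℓp_two_mul_apply {r : ι → 𝕜} {C : ℝ} (hr : ∀ i, ‖r i‖ ≤ C) (x : lp (fun _ : ι ↦ 𝕜) 2) :
    Memℓp (fun i ↦ r i * x i) 2 := by
  have hx : Summable fun i ↦ ‖x i‖ ^ (2 : ℝ) := by
    have h := (lp.memℓp x).summable (by norm_num)
    simpa using h
  rw [memℓp_gen_iff (by norm_num)]
  simp only [ENNReal.toReal_ofNat]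
  refine Summable.of_nonneg_of_le (fun i ↦ by positivity) (fun i ↦ ?_) (hx.mul_left (C ^ 2))
  have hC : 0 ≤ C := (norm_nonneg _).trans (hr i)
  rw [norm_mul, Real.mul_rpow (norm_nonneg _) (norm_nonneg _), Real.rpow_two]
  exact mul_le_mul_of_nonneg_right (pow_le_pow_left₀ (norm_nonneg _) (hr i) 2) (by positivity)

/-- **The diagonal operator of a bounded sequence on `lp (fun _ : ι ↦ 𝕜) 2`**: `(r · x)_i = r_i x_i`, with
`‖r · x‖ ≤ max C 0 · ‖x‖`. [folklore] -/
def lpDiag (r : ι → 𝕜) (C : ℝ) (hr : ∀ i, ‖r i‖ ≤ C) : lp (fun _ : ι ↦ 𝕜) 2 →L[𝕜] lp (fun _ : ι ↦ 𝕜) 2 :=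
  LinearMap.mkContinuous
    { toFun := fun x ↦ ⟨fun i ↦ r i * x i, memℓp_two_mul_apply hr x⟩
      map_add' := fun x y ↦ lp.ext (funext fun i ↦ by
        simp only [lp.coeFn_add, Pi.add_apply, mul_add])
      map_smul' := fun c x ↦ lp.ext (funext fun i ↦ by
        simp only [lp.coeFn_smul, Pi.smul_apply, RingHom.id_apply, smul_eq_mul]
        change r i * (c * x i) = c * (r i * x i)
        ring) }
    (max C 0) (fun x ↦ by
      have h2 : (0 : ℝ) < (2 : ℝ≥0∞).toReal := by norm_num
      refine lp.norm_le_of_tsum_le h2 (by positivity) ?_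
      simp only [ENNReal.toReal_ofNat, LinearMap.coe_mk, AddHom.coe_mk]
      have hx : HasSum (fun i ↦ ‖x i‖ ^ (2 : ℝ)) (‖x‖ ^ (2 : ℝ)) := by
        have h := lp.hasSum_norm h2 x
        simpa using h
      have hle : ∀ i, ‖r i * x i‖ ^ (2 : ℝ) ≤ (max C 0) ^ 2 * ‖x i‖ ^ (2 : ℝ) := fun i ↦ by
        rw [norm_mul, Real.mul_rpow (norm_nonneg _) (norm_nonneg _), Real.rpow_two]
        exact mul_le_mul_of_nonneg_right
          (pow_le_pow_left₀ (norm_nonneg _) ((hr i).trans (le_max_left _ _)) 2) (by positivity)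
      have hsum : Summable fun i ↦ ‖r i * x i‖ ^ (2 : ℝ) := by
        have h := (memℓp_two_mul_apply hr x).summable h2
        simpa using h
      calc ∑' i, ‖r i * x i‖ ^ (2 : ℝ) ≤ ∑' i, (max C 0) ^ 2 * ‖x i‖ ^ (2 : ℝ) :=
            hsum.tsum_le_tsum hle (hx.summable.mul_left _)
        _ = (max C 0 * ‖x‖) ^ (2 : ℝ) := by
            rw [(hx.mul_left _).tsum_eq, Real.rpow_two, Real.rpow_two, mul_pow])

/-- `(lpDiag r x)_i = r_i x_i`. [folklore] -/
@[simp]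
theorem lpDiag_apply (r : ι → 𝕜) (C : ℝ) (hr : ∀ i, ‖r i‖ ≤ C) (x : lp (fun _ : ι ↦ 𝕜) 2) (i : ι) :
    lpDiag r C hr x i = r i * x i := rfl

end LpDiag

/-! ### The diagonal operator of a Hilbert basis -/

section Diag

variable (e : HilbertBasis ι 𝕜 H)

/-- **The diagonal operator `e_i ↦ r_i e_i`** of a bounded scalar sequence `r` in the Hilbert
basis `e` (conjugate `lpDiag` by the isometry `e.repr : H ≃ lp (fun _ : ι ↦ 𝕜) 2`). [folklore] -/
def basisDiag (r : ι → 𝕜) (C : ℝ) (hr : ∀ i, ‖r i‖ ≤ C) : H →L[𝕜] H :=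
  (e.repr.symm.toContinuousLinearEquiv : lp (fun _ : ι ↦ 𝕜) 2 →L[𝕜] H) ∘L (lpDiag r C hr) ∘L
    (e.repr.toContinuousLinearEquiv : H →L[𝕜] lp (fun _ : ι ↦ 𝕜) 2)

variable {e}
variable {r r' : ι → 𝕜} {C C' : ℝ} {hr : ∀ i, ‖r i‖ ≤ C} {hr' : ∀ i, ‖r' i‖ ≤ C'}

/-- Unfolding: `diag r x = e.repr⁻¹ (r · e.repr x)`. [folklore] -/
theorem diag_apply (x : H) : basisDiag e r C hr x = e.repr.symm (lpDiag r C hr (e.repr x)) := rfl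

/-- **Coefficients of `diag r x`**: `(e.repr (diag r x))_i = r_i (e.repr x)_i`. [folklore] -/
@[simp]
theorem repr_diag (x : H) (i : ι) : e.repr (basisDiag e r C hr x) i = r i * e.repr x i := by
  rw [diag_apply, LinearIsometryEquiv.apply_symm_apply, lpDiag_apply]

/-- `⟨e_i, diag r x⟩ = r_i ⟨e_i, x⟩`. [folklore] -/
theorem inner_basis_diag (x : H) (i : ι) : ⟪e i, basisDiag e r C hr x⟫_𝕜 = r i * ⟪e i, x⟫_𝕜 := by
  rw [← HilbertBasis.repr_apply_apply, repr_diag, HilbertBasis.repr_apply_apply]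

/-- `⟨diag r x, e_i⟩ = conj(r_i) ⟨x, e_i⟩`. [folklore] -/
theorem inner_diag_basis (x : H) (i : ι) :
    ⟪basisDiag e r C hr x, e i⟫_𝕜 = conj (r i) * ⟪x, e i⟫_𝕜 := by
  rw [← inner_conj_symm (basisDiag e r C hr x) (e i), inner_basis_diag, map_mul,
    inner_conj_symm x (e i)]

/-- Two vectors with the same coefficients are equal. [folklore] -/
theorem _root_.HilbertBasis.ext_inner (e : HilbertBasis ι 𝕜 H) {x y : H}
    (h : ∀ i, ⟪e i, x⟫_𝕜 = ⟪e i, y⟫_𝕜) : x = y := by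
  apply e.repr.injective
  refine lp.ext (funext fun i ↦ ?_)
  rw [HilbertBasis.repr_apply_apply, HilbertBasis.repr_apply_apply, h i]

/-- **`diag r e_i = r_i e_i`.** [folklore] -/
theorem diag_basis (i : ι) : basisDiag e r C hr (e i) = r i • e i := by
  classical
  refine e.ext_inner fun k ↦ ?_
  rw [inner_basis_diag, inner_smul_right]
  by_cases hk : k = i
  · subst hk; rfl
  · have h0 : ⟪e k, e i⟫_𝕜 = 0 := e.orthonormal.2 hk
    rw [h0, mul_zero, mul_zero]

/-- **Norm bound from a pointwise bound**: if `‖r_i‖ ≤ δ` for all `i` (and `0 ≤ δ`) then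
`‖diag r‖ ≤ δ`. [folklore] -/
theorem norm_diag_le {δ : ℝ} (hδ : 0 ≤ δ) (h : ∀ i, ‖r i‖ ≤ δ) : ‖basisDiag e r C hr‖ ≤ δ := by
  refine ContinuousLinearMap.opNorm_le_bound _ hδ fun x ↦ ?_
  rw [diag_apply, LinearIsometryEquiv.norm_map]
  have h2 : (0 : ℝ) < (2 : ℝ≥0∞).toReal := by norm_num
  have hx : HasSum (fun i ↦ ‖e.repr x i‖ ^ (2 : ℝ)) (‖x‖ ^ (2 : ℝ)) := by
    have h := lp.hasSum_norm h2 (e.repr x)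
    rw [LinearIsometryEquiv.norm_map] at h
    simpa using h
  refine lp.norm_le_of_tsum_le h2 (by positivity) ?_
  simp only [ENNReal.toReal_ofNat, lpDiag_apply]
  have hle : ∀ i, ‖r i * e.repr x i‖ ^ (2 : ℝ) ≤ δ ^ 2 * ‖e.repr x i‖ ^ (2 : ℝ) := fun i ↦ by
    rw [norm_mul, Real.mul_rpow (norm_nonneg _) (norm_nonneg _), Real.rpow_two]
    exact mul_le_mul_of_nonneg_right (pow_le_pow_left₀ (norm_nonneg _) (h i) 2) (by positivity)
  have hsum : Summable fun i ↦ ‖r i * e.repr x i‖ ^ (2 : ℝ) := by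
    have h' := (memℓp_two_mul_apply hr (e.repr x)).summable h2
    simpa using h'
  calc ∑' i, ‖r i * e.repr x i‖ ^ (2 : ℝ) ≤ ∑' i, δ ^ 2 * ‖e.repr x i‖ ^ (2 : ℝ) :=
        hsum.tsum_le_tsum hle (hx.summable.mul_left _)
    _ = (δ * ‖x‖) ^ (2 : ℝ) := by
        rw [(hx.mul_left _).tsum_eq, Real.rpow_two, Real.rpow_two, mul_pow]

/-- **Differences of diagonal operators are diagonal**: `diag r - diag r' = diag (r - r')`.
[folklore] -/
theorem diag_sub_diag :
    basisDiag e r C hr - basisDiag e r' C' hr' = basisDiag e (fun i ↦ r i - r' i) (C + C')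
      (fun i ↦ (norm_sub_le _ _).trans (add_le_add (hr i) (hr' i))) := by
  ext x
  refine e.ext_inner fun i ↦ ?_
  rw [show (basisDiag e r C hr - basisDiag e r' C' hr') x =
      basisDiag e r C hr x - basisDiag e r' C' hr' x from rfl, inner_sub_right, inner_basis_diag,
    inner_basis_diag, inner_basis_diag, sub_mul]

/-- **`diag r` is injective when no `r_i` vanishes.** [folklore] -/
theorem diag_injective (h0 : ∀ i, r i ≠ 0) : Function.Injective (basisDiag e r C hr) := by
  refine (injective_iff_map_eq_zero _).2 fun x hx ↦ ?_
  refine e.ext_inner fun i ↦ ?_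
  have h := inner_basis_diag (e := e) (r := r) (C := C) (hr := hr) x i
  rw [hx, inner_zero_right] at h
  rw [inner_zero_right]
  exact (mul_eq_zero.1 h.symm).resolve_left (h0 i)

/-! #### Finite-rank truncations and compactness -/

/-- The rank-one operator `x ↦ ⟨e_i, x⟩ e_i`. [folklore] -/
def rankOneBasis (e : HilbertBasis ι 𝕜 H) (i : ι) : H →L[𝕜] H :=
  (ContinuousLinearMap.toSpanSingleton 𝕜 (e i)) ∘L (innerSL 𝕜 (e i))

/-- `rankOneBasis e i x = ⟨e_i, x⟩ e_i`. [folklore] -/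
@[simp]
theorem rankOneBasis_apply (i : ι) (x : H) : rankOneBasis e i x = ⟪e i, x⟫_𝕜 • e i := by
  simp [rankOneBasis, ContinuousLinearMap.toSpanSingleton_apply]

/-- Rank-one operators are compact. [folklore] -/
theorem isCompactOperator_rankOneBasis (i : ι) : IsCompactOperator (rankOneBasis e i) :=
  (isCompactOperator_of_locallyCompactSpace_dom (innerSL 𝕜 (e i) : H →L[𝕜] 𝕜)).clm_comp
    (ContinuousLinearMap.toSpanSingleton 𝕜 (e i))

/-- Bound for an indicator-truncated sequence. [folklore] -/
theorem norm_indicator_apply_le (hr : ∀ i, ‖r i‖ ≤ C) (F : Set ι) (i : ι) :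
    ‖F.indicator r i‖ ≤ max C 0 :=
  (norm_indicator_le_norm_self _ _).trans ((hr i).trans (le_max_left _ _))

/-- **The truncation of `diag r` to a finite set of indices is the finite sum
`Σ_{i ∈ F} r_i ⟨e_i, ·⟩ e_i`.** [folklore] -/
theorem diag_indicator_eq_sum (hr : ∀ i, ‖r i‖ ≤ C) (F : Finset ι) :
    basisDiag e ((F : Set ι).indicator r) (max C 0) (norm_indicator_apply_le hr F) =
      ∑ i ∈ F, r i • rankOneBasis e i := by
  classical
  ext x
  refine e.ext_inner fun k ↦ ?_
  rw [inner_basis_diag, FunLike.coe_sum, Finset.sum_apply, inner_sum]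
  simp only [FunLike.coe_smul, Pi.smul_apply, rankOneBasis_apply, inner_smul_right]
  have horth : ∀ i, ⟪e k, e i⟫_𝕜 = if k = i then 1 else 0 := fun i ↦
    orthonormal_iff_ite.1 e.orthonormal k i
  simp_rw [horth, mul_ite, mul_one, mul_zero, Finset.sum_ite_eq]
  by_cases hk : k ∈ F
  · rw [if_pos hk, Set.indicator_of_mem (Finset.mem_coe.2 hk)]
  · rw [if_neg hk, Set.indicator_of_notMem (fun h ↦ hk (Finset.mem_coe.1 h)), zero_mul]

/-- The truncations are compact (finite rank). [folklore] -/
theorem isCompactOperator_diag_indicator (hr : ∀ i, ‖r i‖ ≤ C) (F : Finset ι) :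
    IsCompactOperator (basisDiag e ((F : Set ι).indicator r) (max C 0) (norm_indicator_apply_le hr F)) := by
  classical
  rw [diag_indicator_eq_sum hr]
  induction F using Finset.induction_on with
  | empty =>
    rw [Finset.sum_empty]
    exact isCompactOperator_zero
  | insert a F ha ih =>
    rw [Finset.sum_insert ha]
    exact ((isCompactOperator_rankOneBasis (e := e) a).smul (r a)).add ih

/-- `Re ⟨diag r x, x⟩ = Σ_i Re(r_i) |⟨e_i, x⟩|²` (as a convergent sum). [folklore] -/
theorem hasSum_re_inner_diag_self (x : H) :
    HasSum (fun i ↦ RCLike.re (r i) * ‖⟪e i, x⟫_𝕜‖ ^ 2) (RCLike.re ⟪x, basisDiag e r C hr x⟫_𝕜) := by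
  have h := (e.hasSum_inner_mul_inner x (basisDiag e r C hr x)).mapL RCLike.reCLM
  simp only [RCLike.reCLM_apply] at h
  have hfun : (fun i ↦ RCLike.re (⟪x, e i⟫_𝕜 * ⟪e i, basisDiag e r C hr x⟫_𝕜)) =
      fun i ↦ RCLike.re (r i) * ‖⟪e i, x⟫_𝕜‖ ^ 2 := by
    funext i
    rw [inner_basis_diag, ← inner_conj_symm x (e i), mul_left_comm, RCLike.conj_mul,
      ← RCLike.ofReal_pow, mul_comm (r i), RCLike.re_ofReal_mul, mul_comm]
  rw [hfun] at h
  exact h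

/-! #### Self-adjointness and compactness (complete `H`) -/

section Complete

variable [CompleteSpace H]

/-- **`diag r` is self-adjoint for a real sequence `r`.** [folklore] -/
theorem isSelfAdjoint_diag (hreal : ∀ i, conj (r i) = r i) : IsSelfAdjoint (basisDiag e r C hr) := by
  rw [ContinuousLinearMap.isSelfAdjoint_iff_isSymmetric]
  intro x y
  change ⟪basisDiag e r C hr x, y⟫_𝕜 = ⟪x, basisDiag e r C hr y⟫_𝕜
  have h1 := e.hasSum_inner_mul_inner (basisDiag e r C hr x) y
  have h2 := e.hasSum_inner_mul_inner x (basisDiag e r C hr y)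
  refine h1.unique ?_
  convert h2 using 1
  funext i
  rw [inner_diag_basis, inner_basis_diag, hreal i]
  ring

/-- **A diagonal operator whose entries tend to `0` is compact**: it is the operator-norm limit of
its finite-rank truncations, `‖diag r - diag (1_F r)‖ ≤ sup_{i ∉ F} |r_i|`.
[cite: ReedSimonI1980, Thm. VI.12–VI.13 (norm limits of finite-rank operators are compact)] -/
theorem isCompactOperator_diag (h0 : Tendsto (fun i ↦ ‖r i‖) cofinite (𝓝 0)) :
    IsCompactOperator (basisDiag e r C hr) := by
  classical
  -- the truncations converge in operator norm along `Finset ι`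
  have htend : Tendsto (fun F : Finset ι ↦
      basisDiag e ((F : Set ι).indicator r) (max C 0) (norm_indicator_apply_le hr F)) atTop
      (𝓝 (basisDiag e r C hr)) := by
    rw [Metric.tendsto_atTop]
    intro ε hε
    have hfin : {i | ε / 2 ≤ ‖r i‖}.Finite := by
      have h : ((fun i ↦ ‖r i‖) ⁻¹' Iio (ε / 2))ᶜ.Finite :=
        mem_cofinite.1 (h0 (Iio_mem_nhds (half_pos hε)))
      refine h.subset fun i hi ↦ ?_
      simp only [mem_compl_iff, mem_preimage, mem_Iio, not_lt]
      exact hi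
    refine ⟨hfin.toFinset, fun F hF ↦ ?_⟩
    rw [dist_eq_norm, diag_sub_diag]
    have hbound : ∀ i, ‖(F : Set ι).indicator r i - r i‖ ≤ ε / 2 := fun i ↦ by
      by_cases hi : i ∈ F
      · rw [Set.indicator_of_mem (Finset.mem_coe.2 hi), sub_self, norm_zero]
        exact (half_pos hε).le
      · rw [Set.indicator_of_notMem (fun h ↦ hi (Finset.mem_coe.1 h)), zero_sub, norm_neg]
        by_contra hlt
        exact hi (hF (hfin.mem_toFinset.2 (le_of_lt (not_le.1 hlt))))
    exact (norm_diag_le (half_pos hε).le hbound).trans_lt (half_lt_self hε)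
  exact isCompactOperator_of_tendsto htend
    (Eventually.of_forall fun F ↦ isCompactOperator_diag_indicator hr F)

end Complete

end Diag

/-! ### The perturbed resolvent `R = (1 + D B)⁻¹ D` -/

section Resolvent

variable [CompleteSpace H]

/-- A self-adjoint bounded operator is symmetric: `⟨B x, y⟩ = ⟨x, B y⟩`. [folklore] -/
theorem inner_map_left_eq_of_isSelfAdjoint {B : H →L[𝕜] H} (hB : IsSelfAdjoint B) (x y : H) :
    ⟪B x, y⟫_𝕜 = ⟪x, B y⟫_𝕜 :=
  (ContinuousLinearMap.isSelfAdjoint_iff_isSymmetric.1 hB) x y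

/-- **The perturbed resolvent.** Let `D = diag r` be a compact self-adjoint diagonal operator
(real `r_i → 0`) and `B` bounded self-adjoint with `‖D B‖ < 1`. Then `R = (1 + D B)⁻¹ D`
(Neumann series) satisfies `R x + D B R x = D x`, is compact, and is symmetric
(`⟨R x, y⟩ = ⟨x, R y⟩`: write `R x = D (x - B R x)` and use the symmetry of `D` and `B`).
With `D = (A₀ + c)⁻¹` this is the resolvent `(A₀ + B + c)⁻¹` of the perturbed operator.
[cite: ReedSimonIV1978, Thm. XIII.64 (proof: resolvent of the perturbed operator)] -/
theorem exists_perturbedResolvent (e : HilbertBasis ι 𝕜 H) {r : ι → 𝕜} {C : ℝ}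
    (hr : ∀ i, ‖r i‖ ≤ C) (hreal : ∀ i, conj (r i) = r i)
    (h0 : Tendsto (fun i ↦ ‖r i‖) cofinite (𝓝 0)) (B : H →L[𝕜] H) (hB : IsSelfAdjoint B)
    (hsmall : ‖basisDiag e r C hr ∘L B‖ < 1) :
    ∃ R : H →L[𝕜] H,
      (∀ x, R x + basisDiag e r C hr (B (R x)) = basisDiag e r C hr x) ∧
      IsCompactOperator R ∧ (R : H →ₗ[𝕜] H).IsSymmetric := by
  have hDsym : ∀ x y, ⟪basisDiag e r C hr x, y⟫_𝕜 = ⟪x, basisDiag e r C hr y⟫_𝕜 :=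
    fun x y ↦ inner_map_left_eq_of_isSelfAdjoint (isSelfAdjoint_diag hreal) x y
  have hDc : IsCompactOperator (basisDiag e r C hr) := isCompactOperator_diag h0
  have hBsym : ∀ x y, ⟪B x, y⟫_𝕜 = ⟪x, B y⟫_𝕜 := inner_map_left_eq_of_isSelfAdjoint hB
  set D : H →L[𝕜] H := basisDiag e r C hr with hD
  -- Neumann series for `1 + D B = 1 - (-(D B))`
  have ht : ‖-(D ∘L B)‖ < 1 := by rwa [norm_neg]
  set u : (H →L[𝕜] H)ˣ := Units.oneSub (-(D ∘L B)) ht with hu_def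
  have hu : (u : H →L[𝕜] H) = 1 + D ∘L B := by
    rw [hu_def, Units.val_oneSub, sub_neg_eq_add]
  have hUV : ∀ y, (1 + D ∘L B) ((↑u⁻¹ : H →L[𝕜] H) y) = y := fun y ↦ by
    have h := congrArg (fun T : H →L[𝕜] H ↦ T y) u.mul_inv
    rw [hu] at h
    exact h
  set R : H →L[𝕜] H := (↑u⁻¹ : H →L[𝕜] H) ∘L D with hR
  have hkey : ∀ x, R x + D (B (R x)) = D x := fun x ↦ hUV (D x)
  have hkey' : ∀ x, R x = D (x - B (R x)) := fun x ↦ by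
    rw [map_sub, eq_sub_iff_add_eq]
    exact hkey x
  refine ⟨R, hkey, ?_, ?_⟩
  · -- compact: `R = u⁻¹ ∘ D` with `D` compact
    have h := hDc.clm_comp (↑u⁻¹ : H →L[𝕜] H)
    rwa [hR, ContinuousLinearMap.coe_comp]
  · -- symmetric
    intro x y
    change ⟪R x, y⟫_𝕜 = ⟪x, R y⟫_𝕜
    calc ⟪R x, y⟫_𝕜 = ⟪R x, (y - B (R y)) + B (R y)⟫_𝕜 := by rw [sub_add_cancel]
      _ = ⟪R x, y - B (R y)⟫_𝕜 + ⟪R x, B (R y)⟫_𝕜 := inner_add_right _ _ _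
      _ = ⟪D (x - B (R x)), y - B (R y)⟫_𝕜 + ⟪B (R x), R y⟫_𝕜 := by rw [← hkey' x, hBsym]
      _ = ⟪x - B (R x), D (y - B (R y))⟫_𝕜 + ⟪B (R x), R y⟫_𝕜 := by rw [hDsym]
      _ = ⟪x - B (R x), R y⟫_𝕜 + ⟪B (R x), R y⟫_𝕜 := by rw [← hkey' y]
      _ = ⟪x, R y⟫_𝕜 := by rw [inner_sub_left, sub_add_cancel]

end Resolvent

/-! ### The theorem -/

section Main

variable [CompleteSpace H]

/-- **Eigenbasis of a diagonal operator with levels `→ +∞` under a bounded self-adjoint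
perturbation.** Let `e` be a Hilbert basis of `H`, `d : ι → ℝ` with `d₀ ≤ d_i` and `d_i → +∞`
cofinitely, and `B` a bounded self-adjoint operator. Then there are a Hilbert basis `(f_j)_{j ∈ s}`
of `H` (indexed by a subset `s ⊆ H`, `f_j = j`) and real numbers `λ_j` such that

* `λ_j → +∞` along the cofinite filter, and `λ_j ≥ d₀ - ‖B‖` for every `j`;
* every `f_j` is an eigenvector of `diag(d) + B` with eigenvalue `λ_j`, in coefficients:
  `d_i ⟨e_i, f_j⟩ + ⟨e_i, B f_j⟩ = λ_j ⟨e_i, f_j⟩` for all `i`.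

(Self-adjoint operators with compact resolvent are stable under bounded symmetric
perturbations and have a complete orthonormal set of eigenvectors with eigenvalues `→ ∞`:
Reed–Simon IV, Thm. XIII.64, via the compact symmetric perturbed resolvent
`exists_perturbedResolvent` and the Hilbert–Schmidt theorem.) [cite: ReedSimonIV1978, Thm. XIII.64] -/
theorem exists_hilbertBasis_diag_add (e : HilbertBasis ι 𝕜 H) (d : ι → ℝ) (d₀ : ℝ)
    (hd₀ : ∀ i, d₀ ≤ d i) (hd : Tendsto d cofinite atTop) (B : H →L[𝕜] H)
    (hB : IsSelfAdjoint B) :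
    ∃ (s : Set H) (f : HilbertBasis s 𝕜 H) (lam : s → ℝ),
      ⇑f = ((↑) : s → H) ∧ Tendsto lam cofinite atTop ∧ (∀ j, d₀ - ‖B‖ ≤ lam j) ∧
      ∀ j i, (d i : 𝕜) * ⟪e i, f j⟫_𝕜 + ⟪e i, B (f j)⟫_𝕜 = (lam j : 𝕜) * ⟪e i, f j⟫_𝕜 := by
  -- ### constants and the resolvent entries `ρ_i = (d_i + c)⁻¹`
  set β : ℝ := ‖B‖ with hβ_def
  have hβ : 0 ≤ β := norm_nonneg B
  set c : ℝ := 2 * β + 1 - d₀ with hc_def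
  have hdc : ∀ i, 2 * β + 1 ≤ d i + c := fun i ↦ by rw [hc_def]; linarith [hd₀ i]
  have hdc_pos : ∀ i, 0 < d i + c := fun i ↦ by linarith [hdc i]
  set ρ : ι → ℝ := fun i ↦ (d i + c)⁻¹ with hρ_def
  have hρ_pos : ∀ i, 0 < ρ i := fun i ↦ inv_pos.2 (hdc_pos i)
  have hρ_le : ∀ i, ρ i ≤ (2 * β + 1)⁻¹ := fun i ↦ inv_anti₀ (by linarith) (hdc i)
  set r : ι → 𝕜 := fun i ↦ ((ρ i : ℝ) : 𝕜) with hr_def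
  have hr_norm : ∀ i, ‖r i‖ = ρ i := fun i ↦ by
    rw [hr_def]
    simp only [RCLike.norm_ofReal, abs_of_pos (hρ_pos i)]
  have hr : ∀ i, ‖r i‖ ≤ (2 * β + 1)⁻¹ := fun i ↦ (hr_norm i).le.trans (hρ_le i)
  have hreal : ∀ i, conj (r i) = r i := fun i ↦ RCLike.conj_ofReal _
  have hr0 : ∀ i, r i ≠ 0 := fun i ↦ by
    have h : r i = ((ρ i : ℝ) : 𝕜) := rfl
    rw [h, Ne, RCLike.ofReal_eq_zero]
    exact (hρ_pos i).ne'
  have hρ_tend : Tendsto (fun i ↦ ‖r i‖) cofinite (𝓝 0) := by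
    simp_rw [hr_norm, hρ_def]
    exact (tendsto_atTop_add_const_right _ c hd).inv_tendsto_atTop
  -- ### `D = diag ρ`: `‖D B‖ < 1`
  have hDnorm : ‖basisDiag e r _ hr‖ ≤ (2 * β + 1)⁻¹ := norm_diag_le (by positivity) hr
  have hsmall : ‖basisDiag e r _ hr ∘L B‖ < 1 := by
    calc ‖basisDiag e r _ hr ∘L B‖ ≤ ‖basisDiag e r _ hr‖ * ‖B‖ := opNorm_comp_le _ _
      _ ≤ (2 * β + 1)⁻¹ * β := mul_le_mul_of_nonneg_right hDnorm hβ
      _ < 1 := by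
        rw [inv_mul_lt_iff₀ (by linarith), mul_one]
        linarith
  -- ### the perturbed resolvent and its eigenbasis
  obtain ⟨R, hkey, hRc, hRsym⟩ := exists_perturbedResolvent e hr hreal hρ_tend B hB hsmall
  have hRinj : ∀ x, R x = 0 → x = 0 := fun x hx ↦ by
    have h := hkey x
    rw [hx, map_zero, map_zero, zero_add] at h
    exact (injective_iff_map_eq_zero (basisDiag e r _ hr)).1 (diag_injective hr0) x h.symm
  obtain ⟨s, f, κ, hf, hRf⟩ := exists_hilbertBasis_eigenvectors hRc hRsym
  have hκ0 : ∀ j, κ j ≠ 0 := fun j h0 ↦ by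
    have h1 : R (f j) = 0 := by rw [hRf j, h0]; simp
    exact f.orthonormal.ne_zero j (hRinj _ h1)
  -- ### the coefficient eigen-equation with `λ_j = κ_j⁻¹ - c`
  set lam : s → ℝ := fun j ↦ (κ j)⁻¹ - c with hlam
  have heq : ∀ j i, (d i : 𝕜) * ⟪e i, f j⟫_𝕜 + ⟪e i, B (f j)⟫_𝕜 =
      (lam j : 𝕜) * ⟪e i, f j⟫_𝕜 := by
    intro j i
    have h := hkey (f j)
    rw [hRf j, map_smul, map_smul] at h
    -- coefficients: `κ ⟨e_i, f⟩ + κ ρ_i ⟨e_i, B f⟩ = ρ_i ⟨e_i, f⟩`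
    have h' := congrArg (fun z ↦ ⟪e i, z⟫_𝕜) h
    simp only [inner_add_right, inner_smul_right, inner_basis_diag] at h'
    -- multiply by `(d_i + c) / κ`
    have hκ : ((κ j : ℝ) : 𝕜) ≠ 0 := by exact_mod_cast hκ0 j
    have hinv : ((κ j : ℝ) : 𝕜) * ((κ j : ℝ) : 𝕜)⁻¹ = 1 := mul_inv_cancel₀ hκ
    have hρi : r i * ((d i + c : ℝ) : 𝕜) = 1 := by
      have h : r i = (((d i + c)⁻¹ : ℝ) : 𝕜) := rfl
      rw [h, ← RCLike.ofReal_mul, inv_mul_cancel₀ (hdc_pos i).ne', RCLike.ofReal_one]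
    have hlamj : ((lam j : ℝ) : 𝕜) = ((κ j : ℝ) : 𝕜)⁻¹ - ((d i + c : ℝ) : 𝕜) + (d i : 𝕜) := by
      rw [hlam]
      push_cast
      ring
    rw [hlamj]
    -- from `h'`: `κ z + κ (ρ w) = ρ z` with `z = ⟨e i, f j⟩`, `w = ⟨e i, B f j⟩`
    set z := ⟪e i, f j⟫_𝕜
    set w := ⟪e i, B (f j)⟫_𝕜
    apply mul_left_cancel₀ hκ
    linear_combination ((d i + c : ℝ) : 𝕜) * h' + (z - ((κ j : ℝ) : 𝕜) * w) * hρi - z * hinv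
  -- ### the variational lower bound `λ_j ≥ d₀ - ‖B‖`
  have hlow : ∀ j, d₀ - ‖B‖ ≤ lam j := by
    intro j
    have hunit : ‖f j‖ = 1 := f.orthonormal.1 j
    set g : H := ((lam j : ℝ) : 𝕜) • f j - B (f j) with hg
    have hcoef : ∀ i, ⟪e i, g⟫_𝕜 = (d i : 𝕜) * ⟪e i, f j⟫_𝕜 := fun i ↦ by
      rw [hg, inner_sub_right, inner_smul_right, ← heq j i]
      ring
    -- `Re ⟨f_j, g⟩ = Σ d_i |⟨e_i, f_j⟩|² ≥ d₀ ‖f_j‖² = d₀`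
    have hsum : HasSum (fun i ↦ d i * ‖⟪e i, f j⟫_𝕜‖ ^ 2) (RCLike.re ⟪f j, g⟫_𝕜) := by
      have h := (e.hasSum_inner_mul_inner (f j) g).mapL RCLike.reCLM
      simp only [RCLike.reCLM_apply] at h
      have hfun : (fun i ↦ RCLike.re (⟪f j, e i⟫_𝕜 * ⟪e i, g⟫_𝕜)) =
          fun i ↦ d i * ‖⟪e i, f j⟫_𝕜‖ ^ 2 := by
        funext i
        rw [hcoef i, ← inner_conj_symm (f j) (e i), mul_left_comm, RCLike.conj_mul,
          ← RCLike.ofReal_pow, ← RCLike.ofReal_mul, RCLike.ofReal_re]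
      rw [hfun] at h
      exact h
    have hsum₀ : HasSum (fun i ↦ d₀ * ‖⟪e i, f j⟫_𝕜‖ ^ 2) (d₀ * ‖f j‖ ^ 2) :=
      (hasSum_norm_inner_sq e (f j)).mul_left d₀
    have hle : d₀ * ‖f j‖ ^ 2 ≤ RCLike.re ⟪f j, g⟫_𝕜 :=
      hasSum_le (fun i ↦ mul_le_mul_of_nonneg_right (hd₀ i) (sq_nonneg _)) hsum₀ hsum
    -- `Re ⟨f_j, g⟩ = λ ‖f_j‖² - Re ⟨f_j, B f_j⟩ ≤ λ + ‖B‖`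
    have hre : RCLike.re ⟪f j, g⟫_𝕜 = lam j * ‖f j‖ ^ 2 - RCLike.re ⟪f j, B (f j)⟫_𝕜 := by
      rw [hg, inner_sub_right, inner_smul_right, map_sub, inner_self_eq_norm_sq_to_K,
        ← RCLike.ofReal_pow, ← RCLike.ofReal_mul, RCLike.ofReal_re]
    have hB' : |RCLike.re ⟪f j, B (f j)⟫_𝕜| ≤ ‖B‖ := by
      calc |RCLike.re ⟪f j, B (f j)⟫_𝕜| ≤ ‖⟪f j, B (f j)⟫_𝕜‖ := RCLike.abs_re_le_norm _
        _ ≤ ‖f j‖ * ‖B (f j)‖ := norm_inner_le_norm _ _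
        _ ≤ ‖f j‖ * (‖B‖ * ‖f j‖) := mul_le_mul_of_nonneg_left (B.le_opNorm (f j)) (norm_nonneg _)
        _ = ‖B‖ := by rw [hunit, one_mul, mul_one]
    rw [hre, hunit, one_pow, mul_one, mul_one] at hle
    have := (abs_le.1 hB').1
    linarith
  -- ### positivity of `κ_j` and `λ_j → +∞`
  have hκpos : ∀ j, 0 < κ j := fun j ↦ by
    have h1 : 0 < lam j + c := by
      have := hlow j
      rw [hc_def]
      linarith
    have h2 : lam j + c = (κ j)⁻¹ := by rw [hlam]; ring
    rw [h2] at h1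
    exact inv_pos.1 h1
  have hκtend : Tendsto κ cofinite (𝓝 0) := by
    have h := tendsto_norm_eigenvalue_cofinite hRc f.orthonormal hRf
    have h' : (fun j ↦ ‖((κ j : ℝ) : 𝕜)‖) = κ := by
      funext j
      rw [RCLike.norm_ofReal, abs_of_pos (hκpos j)]
    rwa [h'] at h
  have hlamtend : Tendsto lam cofinite atTop := by
    have h1 : Tendsto κ cofinite (𝓝[>] 0) :=
      tendsto_nhdsWithin_iff.2 ⟨hκtend, Eventually.of_forall hκpos⟩
    have h2 := h1.inv_tendsto_nhdsGT_zero
    have h3 := tendsto_atTop_add_const_right _ (-c) h2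
    refine h3.congr fun j ↦ ?_
    show (κ j)⁻¹ + -c = (κ j)⁻¹ - c
    ring
  exact ⟨s, f, lam, hf, hlamtend, hlow, heq⟩

end Main

end Literature.Analysis.OperatorTheory
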